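import Summits.HubbardSuperconductivity.HubbardSuperconductivity.Theorems.AnisotropyChordSpinMonotoneCompleteMultipartite

/-!
# Route `AnisotropyChord`: twin-symmetric states are functions of the PART OCCUPATIONS
# (exact lumping, step 1: sector ground states of a complete multipartite graph depend on a
# configuration only through the number of down spins in each part)

* `apply_eq_of_partCount_eq` — abstract: `p : V → P` a labelling ("parts"); if `ψ` is invariant under
  the transposition of any two vertices with the same label (`ψ (σ ∘ swap x y) = ψ σ` whenever
  `p x = p y`), then `ψ σ = ψ τ` for any two spin-½ configurations `σ, τ` with the same number of down
  spins in every part.  Proof: induction on the Hamming distance; a mismatch `σ v ≠ τ v` is repaired by a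
  transposition inside the part of `v` (counting: the part contains an opposite mismatch).
* `completeMultipartite_sectorGS_apply_eq_of_partCount_eq` — on a connected complete multipartite graph
  (non-adjacency = same part) every sector ground vector of `H(Δ) = xxzHamiltonian 1 G (−1) Δ` is such a
  function (`completeMultipartite_comp_swap_eq_self`: twins are exchangeable by Perron–Frobenius), with
  the part labelling `p x = p y ↔ ¬ G.Adj x y` given by any map constant exactly on non-adjacent pairs;
  `completeEquipartite_sectorGS_apply_eq` — `K_r(t) = completeEquipartiteGraph r t`, parts = first
  coordinate.

The lumped (birth–death) eigen-equation on `K_{m,m}` and the resulting total positivity are in the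
companion files.  H. Tasaki (2020) §2.4 (Perron–Frobenius); J. Kemeny, J. Snell, *Finite Markov Chains*
(1960) §6.3 (lumpability).  No definition is introduced.
-/

set_option linter.dupNamespace false

noncomputable section

namespace Summit.HubbardSuperconductivity.HubbardSuperconductivity.Theorems.AnisotropyChord

open Matrix Complex Finset
open Literature.MathematicalPhysics.QuantumLattice Literature.Probability.LatticeModels

/-! ### Abstract: twin-exchangeable functions depend only on part occupations -/

section Abstract

variable {V P β : Type*} [Fintype V] [DecidableEq V] [DecidableEq P]

omit [Fintype V] [DecidableEq P] in
/-- Composing with the transposition of `v, w` exchanges the two values. [folklore] -/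
theorem comp_swap_apply_left (σ : V → Fin 2) (v w : V) : (σ ∘ Equiv.swap v w) v = σ w := by
  simp [Function.comp_apply, Equiv.swap_apply_left]

omit [Fintype V] [DecidableEq P] in
/-- Composing with the transposition of `v, w` exchanges the two values. [folklore] -/
theorem comp_swap_apply_right (σ : V → Fin 2) (v w : V) : (σ ∘ Equiv.swap v w) w = σ v := by
  simp [Function.comp_apply, Equiv.swap_apply_right]

omit [Fintype V] [DecidableEq P] in
/-- Off `v, w` the transposition does nothing. [folklore] -/
theorem comp_swap_apply_of_ne (σ : V → Fin 2) {v w u : V} (hv : u ≠ v) (hw : u ≠ w) :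
    (σ ∘ Equiv.swap v w) u = σ u := by
  simp [Function.comp_apply, Equiv.swap_apply_of_ne_of_ne hv hw]

/-- **Twin-exchangeable functions are functions of the part occupations.**  Let `p : V → P` label
the vertices and let `ψ` satisfy `ψ (σ ∘ swap x y) = ψ σ` whenever `p x = p y`.  If two configurations
`σ, τ : V → Fin 2` have, in every part, the same number of sites with value `1`, then `ψ σ = ψ τ`.
(Induction on the Hamming distance.)  Kemeny–Snell (1960) §6.3. [folklore] -/
theorem apply_eq_of_partCount_eq (p : V → P) {ψ : (V → Fin 2) → β}
    (hswap : ∀ x y : V, p x = p y → ∀ σ : V → Fin 2, ψ (σ ∘ Equiv.swap x y) = ψ σ)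
    {σ τ : V → Fin 2}
    (hcount : ∀ c : P, (Finset.univ.filter fun v => p v = c ∧ σ v = 1).card =
      (Finset.univ.filter fun v => p v = c ∧ τ v = 1).card) :
    ψ σ = ψ τ := by
  have fin2 : ∀ t : Fin 2, t = 0 ∨ t = 1 := by decide
  -- induction on the Hamming distance, for all `σ` with the right part counts
  suffices h : ∀ (d : ℕ) (σ : V → Fin 2), (Finset.univ.filter fun v => σ v ≠ τ v).card = d →
      (∀ c : P, (Finset.univ.filter fun v => p v = c ∧ σ v = 1).card =
        (Finset.univ.filter fun v => p v = c ∧ τ v = 1).card) → ψ σ = ψ τ from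
    h _ σ rfl hcount
  intro d
  induction d using Nat.strong_induction_on with
  | _ d ih =>
    intro σ hd hc
    by_cases h0 : (Finset.univ.filter fun v => σ v ≠ τ v) = ∅
    · have : σ = τ := by
        funext v
        by_contra hv
        have : v ∈ (Finset.univ.filter fun v => σ v ≠ τ v) := Finset.mem_filter.2 ⟨Finset.mem_univ _, hv⟩
        rw [h0] at this
        exact absurd this (Finset.notMem_empty v)
      rw [this]
    obtain ⟨v, hv⟩ := Finset.nonempty_iff_ne_empty.2 h0
    have hvne : σ v ≠ τ v := (Finset.mem_filter.1 hv).2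
    -- an opposite mismatch `w` in the part of `v`
    obtain ⟨w, hpw, hσw, hτw⟩ : ∃ w, p w = p v ∧ σ w = τ v ∧ τ w = σ v := by
      set S : Finset V := Finset.univ.filter fun u => p u = p v ∧ σ u = 1 with hS
      set T : Finset V := Finset.univ.filter fun u => p u = p v ∧ τ u = 1 with hT
      have hST : S.card = T.card := hc (p v)
      rcases fin2 (σ v) with hσv | hσv <;> rcases fin2 (τ v) with hτv | hτv
      · exact absurd (hσv.trans hτv.symm) hvne
      · -- σ v = 0, τ v = 1: find w ∈ S \ T
        by_contra hne
        push Not at hne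
        have hsub : S ⊆ T := by
          intro u hu
          obtain ⟨hpu, hσu⟩ := (Finset.mem_filter.1 hu).2
          refine Finset.mem_filter.2 ⟨Finset.mem_univ _, hpu, ?_⟩
          rcases fin2 (τ u) with hτu | hτu
          · exact absurd (hτu.trans hσv.symm) (hne u hpu (hσu.trans hτv.symm))
          · exact hτu
        have hvT : v ∈ T := Finset.mem_filter.2 ⟨Finset.mem_univ _, rfl, hτv⟩
        have hvS : v ∉ S := fun h => by
          have := (Finset.mem_filter.1 h).2.2; rw [hσv] at this; exact absurd this (by decide)
        have hss : S ⊂ T := Finset.ssubset_iff_subset_ne.2 ⟨hsub, fun h => hvS (h ▸ hvT)⟩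
        exact absurd hST (Finset.card_lt_card hss).ne
      · -- σ v = 1, τ v = 0: find w ∈ T \ S
        by_contra hne
        push Not at hne
        have hsub : T ⊆ S := by
          intro u hu
          obtain ⟨hpu, hτu⟩ := (Finset.mem_filter.1 hu).2
          refine Finset.mem_filter.2 ⟨Finset.mem_univ _, hpu, ?_⟩
          rcases fin2 (σ u) with hσu | hσu
          · exact absurd (hτu.trans hσv.symm) (hne u hpu (hσu.trans hτv.symm))
          · exact hσu
        have hvS : v ∈ S := Finset.mem_filter.2 ⟨Finset.mem_univ _, rfl, hσv⟩
        have hvT : v ∉ T := fun h => by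
          have := (Finset.mem_filter.1 h).2.2; rw [hτv] at this; exact absurd this (by decide)
        have hss : T ⊂ S := Finset.ssubset_iff_subset_ne.2 ⟨hsub, fun h => hvT (h ▸ hvS)⟩
        exact absurd hST.symm (Finset.card_lt_card hss).ne
      · exact absurd (hσv.trans hτv.symm) hvne
    have hwv : w ≠ v := by
      rintro rfl; exact hvne hσw
    -- repair both mismatches by the transposition `(v w)`
    set σ' : V → Fin 2 := σ ∘ Equiv.swap v w with hσ'
    have hψ' : ψ σ' = ψ σ := hswap v w hpw.symm σ
    have hσ'v : σ' v = τ v := by rw [hσ', comp_swap_apply_left, hσw]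
    have hσ'w : σ' w = τ w := by rw [hσ', comp_swap_apply_right, hτw]
    have hσ'u : ∀ u, u ≠ v → u ≠ w → σ' u = σ u := fun u huv huw => by
      rw [hσ', comp_swap_apply_of_ne σ huv huw]
    -- the Hamming distance drops by two
    have hfilter : (Finset.univ.filter fun u => σ' u ≠ τ u) =
        (Finset.univ.filter fun u => σ u ≠ τ u) \ {v, w} := by
      ext u
      simp only [Finset.mem_filter, Finset.mem_univ, true_and, Finset.mem_sdiff, Finset.mem_insert,
        Finset.mem_singleton]
      constructor
      · intro hu
        have huv : u ≠ v := fun h => by rw [h, hσ'v] at hu; exact hu rfl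
        have huw : u ≠ w := fun h => by rw [h, hσ'w] at hu; exact hu rfl
        rw [hσ'u u huv huw] at hu
        exact ⟨hu, fun h => h.elim huv huw⟩
      · rintro ⟨hu, h⟩
        push Not at h
        rw [hσ'u u h.1 h.2]
        exact hu
    have hwmem : w ∈ (Finset.univ.filter fun u => σ u ≠ τ u) := by
      refine Finset.mem_filter.2 ⟨Finset.mem_univ _, ?_⟩
      rw [hτw]
      intro h
      exact hvne (h.symm.trans hσw)
    have hcard' : (Finset.univ.filter fun u => σ' u ≠ τ u).card = d - 2 := by
      rw [hfilter, Finset.card_sdiff_of_subset, Finset.card_pair (Ne.symm hwv), hd]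
      intro u hu
      rcases Finset.mem_insert.1 hu with rfl | hu
      · exact hv
      · rw [Finset.mem_singleton.1 hu]; exact hwmem
    have hd2 : 2 ≤ d := by
      rw [← hd]
      have : ({v, w} : Finset V) ⊆ (Finset.univ.filter fun u => σ u ≠ τ u) := by
        intro u hu
        rcases Finset.mem_insert.1 hu with rfl | hu
        · exact hv
        · rw [Finset.mem_singleton.1 hu]; exact hwmem
      have h2 := Finset.card_le_card this
      rwa [Finset.card_pair (Ne.symm hwv)] at h2
    -- part counts are preserved by a transposition inside a part
    have hcount' : ∀ c : P, (Finset.univ.filter fun u => p u = c ∧ σ' u = 1).card =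
        (Finset.univ.filter fun u => p u = c ∧ τ u = 1).card := by
      intro c
      rw [← hc c]
      refine Finset.card_equiv (Equiv.swap v w) fun u => ?_
      simp only [Finset.mem_filter, Finset.mem_univ, true_and, hσ', Function.comp_apply]
      have hp : p (Equiv.swap v w u) = p u := by
        by_cases huv : u = v
        · rw [huv, Equiv.swap_apply_left, hpw]
        · by_cases huw : u = w
          · rw [huw, Equiv.swap_apply_right, hpw]
          · rw [Equiv.swap_apply_of_ne_of_ne huv huw]
      rw [hp]
    rw [← hψ']
    exact ih (d - 2) (by omega) σ' hcard' hcount'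

end Abstract

/-! ### Complete multipartite graphs -/

variable {V : Type*} [Fintype V] [DecidableEq V]

/-- **Sector ground states of a connected complete multipartite graph are functions of the part
occupations**: if `p : V → P` is constant exactly on non-adjacent pairs (`p x = p y → ¬ G.Adj x y`),
then any sector ground vector `ψ` of `H(Δ)` takes the same value on configurations with equal numbers
of down spins in every part (twins are exchangeable: `completeMultipartite_comp_swap_eq_self`).
Tasaki (2020) §2.4; Kemeny–Snell (1960) §6.3. [folklore] -/
theorem completeMultipartite_sectorGS_apply_eq_of_partCount_eq {P : Type*} [DecidableEq P]
    (G : SimpleGraph V) [DecidableRel G.Adj] (hG : G.Connected) (hcm : G.IsCompleteMultipartite)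
    (p : V → P) (hp : ∀ x y, p x = p y → ¬ G.Adj x y) (Δ M : ℝ)
    {ψ : TensorIndex V 2 → ℂ} (hψ : ψ ∈ spinZSector (Λ := V) 1 M)
    (hH : xxzHamiltonian 1 G (-1) Δ *ᵥ ψ =
      ((lowestEnergyInSector 1 (xxzHamiltonian 1 G (-1) Δ) M : ℝ) : ℂ) • ψ)
    {σ τ : V → Fin 2}
    (hcount : ∀ c : P, (Finset.univ.filter fun v => p v = c ∧ σ v = 1).card =
      (Finset.univ.filter fun v => p v = c ∧ τ v = 1).card) :
    ψ σ = ψ τ :=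
  apply_eq_of_partCount_eq p
    (fun x y hxy ρ => completeMultipartite_comp_swap_eq_self G hG hcm Δ M hψ hH (hp x y hxy) ρ) hcount

/-- **`K_r(t)`**: sector ground states of `xxzHamiltonian 1 (completeEquipartiteGraph r t) (−1) Δ`
(`r ≥ 2`, `t ≥ 1`) take equal values on configurations with the same number of down spins in each of the
`r` parts (part = first coordinate). [folklore] -/
theorem completeEquipartite_sectorGS_apply_eq {r t : ℕ} (hr : 2 ≤ r) (ht : 0 < t) (Δ M : ℝ)
    {ψ : TensorIndex (Fin r × Fin t) 2 → ℂ}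
    (hψ : ψ ∈ spinZSector (Λ := Fin r × Fin t) 1 M)
    (hH : xxzHamiltonian 1 (SimpleGraph.completeEquipartiteGraph r t) (-1) Δ *ᵥ ψ =
      ((lowestEnergyInSector 1 (xxzHamiltonian 1 (SimpleGraph.completeEquipartiteGraph r t) (-1) Δ)
        M : ℝ) : ℂ) • ψ)
    {σ τ : (Fin r × Fin t) → Fin 2}
    (hcount : ∀ i : Fin r, (Finset.univ.filter fun v : Fin r × Fin t => v.1 = i ∧ σ v = 1).card =
      (Finset.univ.filter fun v : Fin r × Fin t => v.1 = i ∧ τ v = 1).card) :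
    ψ σ = ψ τ :=
  completeMultipartite_sectorGS_apply_eq_of_partCount_eq (SimpleGraph.completeEquipartiteGraph r t)
    (completeEquipartiteGraph_connected hr ht) SimpleGraph.completeEquipartiteGraph.isCompleteMultipartite
    Prod.fst (fun x y hxy => by rw [SimpleGraph.completeEquipartiteGraph_adj]; exact fun h => h hxy)
    Δ M hψ hH hcount

end Summit.HubbardSuperconductivity.HubbardSuperconductivity.Theorems.AnisotropyChord
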